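import Summits.HodgeConjecture.HodgeConjecture.Theorems.Ring2AbelianAllAndreWeilLineTransport
import Literature.AlgebraicGeometry.HodgeTheory.WeilClassesMoonenZarhinCriterion
import HarnessLib

/-!
# Ring 2 · AbelianAll — ANDRÉ AXIS, PART R-a: THE WEIL CLASSES OF A CM FIELD `E ⊂ End⁰` OF ANY DEGREE ARE FLAT FOR THE GLOBAL `E`-ACTION —
  on a compact abelian pencil with ONE global endomorphism `Φ` over the base and `Φ`-compatible charts `(A_s, e_s, φ_s)`, a global class whose
  restriction to ONE member lies in `W_E(A_t, φ_t) ⊗ ℂ = weilClassesField (A t) (φ t) P r` (Moonen–Zarhin's `⊕_σ ⋀ʳ V_{ℂ,σ}`) restricts into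
  `W_E(A_s, φ_s) ⊗ ℂ` at EVERY member (fact-free; part L-e was the imaginary-quadratic case `P = T² + d`, one eigenline at a time)

HONEST FRAMING (page 1, verbatim): **research route, not a corollary; conditional on HC_CM plus one named minimal statement.** Cell line:
research route conditional on HC_CM; not a corollary; Q11.4-sentence-2 already refuted in dim ≥ 3. Nothing in this file is Hodge-theoretic and
nothing proves a case of the Hodge conjecture or of `B(X)` for a named `X`; `HC_CM`, `HC_AV`, the global nodes and Verdier's binder are ABSENT.
Item `Theses.RankFourFaces.CMToAbelian` (stmt-16267) stays OPEN; N104 untouched; no node is born (0 `def`, 0 `sorry`, no named fact). Seat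
`pub-hodge-ring2-ab-andre-2`, gen 48 (part R: the André axis for CM fields). Part L-e (`…AndreWeilLineTransport`) proved that the `χ`-EIGENCLASS
spaces `pullbackEigenclasses A φ k χ` (`(x·𝟙 + y·φ)^* c = χ(x,y)·c` for all test endomorphisms) correspond under the charted parallel transport, and
deduced the flatness of the two Weil LINES `E_± = ⋀^{2n} V_±` of an imaginary-quadratic `K = ℚ(φ)`, `φ² = −d`. For a field `F = ℚ(φ) ≅ ℚ[T]/(P)` of
ANY degree `e` the complexified space of Weil classes is the SUM `weilClassesField A φ P r = ⨆_{P(ρ)=0} pullbackEigenclasses A φ r ((x + yρ)ʳ)`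
(`Literature/…/WeilClassesMoonenZarhinCriterion`, Moonen–Zarhin 1998 §1: `W_F ⊗ ℂ = ⊕_{σ} ⋀ʳ_ℂ V_{ℂ,σ}`), and a class of the sum is not an
eigenclass; what transports it is the OPERATOR statement behind L-e: the charted transport `T = e_B^* ∘ γ_* ∘ (e_A⁻¹)^*` intertwines every test
pull-back `(x·𝟙_A + y·φ)^*` with `(x·𝟙_B + y·ψ)^*` on all of `Hᵏ` (§1), hence maps each summand into the corresponding summand and the sum into the sum.

## Content (theorems only; standard axioms)

* §1 **`map_transport_map_test_eq`** — the intertwining identity `T ∘ (x·𝟙_A + y·φ)^* = (x·𝟙_B + y·ψ)^* ∘ T` on `Hᵏ(A(ℂ); ℂ)` for the charted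
  transport along a homotopy class of paths in a cohomologically locally trivial `U` (L-e's internal step, exported): both sides are multiplicative
  on the iterated cup products `v₁ ⌣ ⋯ ⌣ v_k` of degree-one classes, which span `Hᵏ` of an abelian variety, and agree on `H¹` (`(x·𝟙 + y·φ)^* =
  x + yφ^*` there; `T φ^* = ψ^* T` by `transportFun_map_fiberHom`). **`map_transport_mem_pullbackEigenclasses`** (each `χ`-eigenclass space is
  carried into the `χ`-eigenclass space), **`map_transport_mem_weilClassesField`** (hence `W_F(A, φ) ⊗ ℂ` into `W_F(B, ψ) ⊗ ℂ`, for every `P`, `r`),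
  **`mem_weilClassesField_of_transport`** (restrictions of a global class: `e_A^*(W|X_t) ∈ W_F(A, φ) ⊗ ℂ ⟹ e_B^*(W|X_s) ∈ W_F(B, ψ) ⊗ ℂ`).
* §2 (compact abelian pencils, any two members; Ehresmann + path-connectedness of `S(ℂ)`) **`map_chart_fiberι_mem_weilClassesField_member_of_member`**
  — on a compact pencil of abelian varieties with a global endomorphism `Φ` over `S` and `Φ`-compatible charts `(A_s, e_s, φ_s)`, a global class
  `U ∈ Hʳ(𝒳(ℂ); ℂ)` with `e_t^*(U|X_t) ∈ weilClassesField (A t) (φ t) P r` at ONE member has `e_s^*(U|X_s) ∈ weilClassesField (A s) (φ s) P r` at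
  EVERY member. This is the hypothesis-transport behind part R-b's rows (the André axis for Weil classes relative to a CM field of any degree).

## Honest status

Fact-free bookkeeping on the carriers (no Hodge theory: the `E`-action need not be of Weil type, `P` need not be irreducible). In print the
statement is Deligne's "`⋀_E^d H¹(Y_s)` is a sub-local system for an abelian scheme with `E`-action" (LNM 900, proof of Thm. 4.8) and André's "section
globale `ξ̃` de `R^{2p} f_* ℚ(p)`" (Lemme 6.3.3 (iii)); the tree adds the hypothesis-explicit per-pencil form from ONE global endomorphism (no
abelian-scheme structure constructed). Strength of the open instances unchanged; nothing minimal claimed; N104 untouched. EDGE LABELS: §1–§2 K (fact-free).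
References: Deligne1982HodgeCycles (§4, proof of Thm. 4.8, pp. 48–50: the `E`-action on `Y/S`, `t_s` flat); MoonenZarhin1998WeilClasses (§1:
`W_F ⊗ ℂ = ⊕_σ ⋀ʳ V_{ℂ,σ}`, `ρ(f)(w) = fʳ·w`); Andre1996Motifs (§6.3 Lemme 6.3.3 (iii), p. 33); VoisinHodgeII2003 (§3.1.2); VoisinHodgeI2002 (§9.2.1,
Thm. 9.3); MumfordAV1970 (§1 (4), `H^• = ⋀ H¹`).
-/

noncomputable section

set_option linter.dupNamespace false

namespace Summit.HodgeConjecture.HodgeConjecture.Ring2.AbelianAll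

open CategoryTheory AlgebraicGeometry
open _root_.Topology _root_.Filter
open Literature.AlgebraicGeometry Literature.AlgebraicGeometry.Motives
open Literature.AlgebraicGeometry.HodgeTheory
open Literature.AlgebraicTopology.SingularHomology (singularCohomology cupProduct cupPowOne map_cupPowOne)

/-! ## §1 Along a path: the charted transport intertwines the test pull-backs; eigenclass spaces and `W_F ⊗ ℂ` correspond -/

section Transport

variable {𝒳 S : SchemeOver ℂ} (π : 𝒳 ⟶ S) {U : Set (ComplexPoints S)}

/-- **The charted transport intertwines the test pull-backs on ALL of `Hᵏ`.** Let `π : 𝒳 ⟶ S` be cohomologically locally trivial over `U`, `Φ` an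
endomorphism of `𝒳` OVER `S` with fibre maps `Φ_u` (`Φ_u ≫ ι_u = ι_u ≫ Φ`), `γ` a homotopy class of paths from `t` to `s` in `U`, and `e_A : A ≅ X_t`,
`e_B : B ≅ X_s` charts by abelian varieties with endomorphisms `φ`, `ψ` matching `Φ_t`, `Φ_s`. Then for every `c ∈ Hᵏ(A(ℂ); ℂ)` and all `x y : ℕ`,
`e_B^* γ_* (e_A⁻¹)^* ((x·𝟙_A + y·φ)^* c) = (x·𝟙_B + y·ψ)^* (e_B^* γ_* (e_A⁻¹)^* c)`: on `H¹` the test pull-backs are `x + yφ^*`, `x + yψ^*`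
(`complexBetti_map_nsmul_id_add_nsmul_one`) and `γ_*` intertwines `Φ_t^*` with `Φ_s^*` (`transportFun_map_fiberHom`); all maps are multiplicative
on `v₁ ⌣ ⋯ ⌣ v_k` (`transportFun_cupPowOne`, `map_cupPowOne`), and these products span `Hᵏ(A(ℂ); ℂ)`
(`AbelianVariety.hasExteriorCohomologyH1_complexPoints`). Part L-e's internal step, exported. [cite: Deligne1982HodgeCycles, §4 proof of Thm. 4.8 (pp. 48–50)]
[cite: VoisinHodgeII2003, §3.1.2] [cite: MumfordAV1970, §1 (4)] -/
theorem map_transport_map_test_eq (hU : IsCohomologicallyLocallyTrivialOn π U) (Φ : 𝒳 ⟶ 𝒳) (hΦ : Φ ≫ π = π)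
    (Φf : ∀ u : ComplexPoints S, fiberOver π u ⟶ fiberOver π u) (hΦf : ∀ u, Φf u ≫ fiberι π u = fiberι π u ≫ Φ)
    {t s : U} (γ : Path.Homotopic.Quotient t s)
    {A B : AbelianVariety ℂ} (eA : A.X ≅ fiberOver π t.1) (eB : B.X ≅ fiberOver π s.1) {φ : A ⟶ A} {ψ : B ⟶ B}
    (heA : eA.hom ≫ Φf t.1 = φ.hom.hom.hom ≫ eA.hom) (heB : eB.hom ≫ Φf s.1 = ψ.hom.hom.hom ≫ eB.hom)
    (k : ℕ) (x y : ℕ) (c : complexBetti A.X k) :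
    complexBetti.map eB.hom k (transportFun π k hU γ (complexBetti.map eA.inv k
        (complexBetti.map (x • 𝟙 A + y • φ).hom.hom.hom k c))) =
      complexBetti.map (x • 𝟙 B + y • ψ).hom.hom.hom k
        (complexBetti.map eB.hom k (transportFun π k hU γ (complexBetti.map eA.inv k c))) := by
  -- `φ`-equivariance of the conjugated transport on `H¹`, through the charts
  have hinv : eA.inv ≫ φ.hom.hom.hom = Φf t.1 ≫ eA.inv := by
    rw [Iso.inv_comp_eq, ← Category.assoc, heA, Category.assoc, Iso.hom_inv_id, Category.comp_id]
  have h1 : ∀ z, complexBetti.map eA.inv 1 (complexBetti.map φ.hom.hom.hom 1 z) =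
      complexBetti.map (Φf t.1) 1 (complexBetti.map eA.inv 1 z) := fun z => by
    have hc := congrArg (fun F => complexBetti.map F 1 z) hinv
    simpa only [complexBetti.map_comp, ModuleCat.comp_apply] using hc
  have h2 : ∀ z, complexBetti.map eB.hom 1 (complexBetti.map (Φf s.1) 1 z) =
      complexBetti.map ψ.hom.hom.hom 1 (complexBetti.map eB.hom 1 z) := fun z => by
    have hc := congrArg (fun F => complexBetti.map F 1 z) heB
    simpa only [complexBetti.map_comp, ModuleCat.comp_apply] using hc
  -- the test pull-backs `(x·𝟙 + y·φ)^*` are intertwined on `H¹`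
  have hT1 : ∀ z : complexBetti A.X 1,
      complexBetti.map eB.hom 1 (transportFun π 1 hU γ (complexBetti.map eA.inv 1
        (complexBetti.map (x • 𝟙 A + y • φ).hom.hom.hom 1 z))) =
      complexBetti.map (x • 𝟙 B + y • ψ).hom.hom.hom 1
        (complexBetti.map eB.hom 1 (transportFun π 1 hU γ (complexBetti.map eA.inv 1 z))) := fun z => by
    rw [complexBetti_map_nsmul_id_add_nsmul_one, complexBetti_map_nsmul_id_add_nsmul_one, map_add, map_smul, map_smul,
      transportFun_add, transportFun_smul, transportFun_smul, map_add, map_smul, map_smul, h1,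
      transportFun_map_fiberHom π 1 hU Φ hΦ Φf hΦf γ, h2]
  -- … hence on `H^k`, spanned by the `k`-fold cup products of degree-one classes
  have hc : c ∈ Submodule.span ℂ (Set.range (cupPowOne ℂ (ComplexPoints A.X) k)) := by
    rw [(Motives.AbelianVariety.hasExteriorCohomologyH1_complexPoints A).span_range_cupPowOne k]
    exact Submodule.mem_top
  -- pull-backs along scheme morphisms are multiplicative on `v₁ ⌣ ⋯ ⌣ v_k`
  have e1 : ∀ {X' Y' : SchemeOver ℂ} (g : X' ⟶ Y') (v : Fin k → complexBetti Y' 1),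
      complexBetti.map g k (cupPowOne ℂ (ComplexPoints Y') k v) =
        cupPowOne ℂ (ComplexPoints X') k (fun i => complexBetti.map g 1 (v i)) := fun g v => map_cupPowOne _ k v
  induction hc using Submodule.span_induction with
  | mem c hc =>
    obtain ⟨w, rfl⟩ := hc
    simp only [e1, transportFun_cupPowOne, hT1]
  | zero => simp only [map_zero, transportFun_zero]
  | add c c' _ _ hc hc' => simp only [map_add, transportFun_add, hc, hc']
  | smul a c _ hc => simp only [map_smul, transportFun_smul, hc]

/-- **Each `χ`-eigenclass space is carried into the `χ`-eigenclass space by the charted transport** (the class-level form of part L-e's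
`mem_pullbackEigenclasses_of_transport`, now for an arbitrary class `c ∈ Hᵏ(A(ℂ); ℂ)` rather than the restriction of a global class).
[cite: Deligne1982HodgeCycles, §4 proof of Thm. 4.8 (pp. 48–50)] [cite: MoonenZarhin1998WeilClasses, §1] -/
theorem map_transport_mem_pullbackEigenclasses (hU : IsCohomologicallyLocallyTrivialOn π U) (Φ : 𝒳 ⟶ 𝒳) (hΦ : Φ ≫ π = π)
    (Φf : ∀ u : ComplexPoints S, fiberOver π u ⟶ fiberOver π u) (hΦf : ∀ u, Φf u ≫ fiberι π u = fiberι π u ≫ Φ)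
    {t s : U} (γ : Path.Homotopic.Quotient t s)
    {A B : AbelianVariety ℂ} (eA : A.X ≅ fiberOver π t.1) (eB : B.X ≅ fiberOver π s.1) {φ : A ⟶ A} {ψ : B ⟶ B}
    (heA : eA.hom ≫ Φf t.1 = φ.hom.hom.hom ≫ eA.hom) (heB : eB.hom ≫ Φf s.1 = ψ.hom.hom.hom ≫ eB.hom)
    (k : ℕ) (χ : ℕ → ℕ → ℂ) {c : complexBetti A.X k} (hc : c ∈ pullbackEigenclasses A φ k χ) :
    complexBetti.map eB.hom k (transportFun π k hU γ (complexBetti.map eA.inv k c)) ∈ pullbackEigenclasses B ψ k χ := by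
  rw [mem_pullbackEigenclasses_iff] at hc ⊢
  intro x y
  have hxy := hc x y
  change complexBetti.map (x • 𝟙 A + y • φ).hom.hom.hom k c = _ at hxy
  change complexBetti.map (x • 𝟙 B + y • ψ).hom.hom.hom k _ = _
  rw [← map_transport_map_test_eq π hU Φ hΦ Φf hΦf γ eA eB heA heB k x y c, hxy, map_smul, transportFun_smul, map_smul]

/-- **`W_F(A, φ) ⊗ ℂ` is carried into `W_F(B, ψ) ⊗ ℂ` by the charted transport**, for every `P ∈ ℤ[T]` and every degree `r`: the complexified space
of Weil classes is the sum over the complex roots `ρ` of `P` of the `(x + yρ)ʳ`-eigenclass spaces (`weilClassesField`, Moonen–Zarhin's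
`W_F ⊗ ℂ = ⊕_σ ⋀ʳ V_{ℂ,σ}`), the transport is linear (`transportLinear`) and maps each summand into the corresponding summand.
[cite: MoonenZarhin1998WeilClasses, §1 (W_F ⊗ ℂ = ⊕_σ ⋀^r V_{ℂ,σ})] [cite: Deligne1982HodgeCycles, §4 proof of Thm. 4.8 (pp. 48–50)] -/
theorem map_transport_mem_weilClassesField (hU : IsCohomologicallyLocallyTrivialOn π U) (Φ : 𝒳 ⟶ 𝒳) (hΦ : Φ ≫ π = π)
    (Φf : ∀ u : ComplexPoints S, fiberOver π u ⟶ fiberOver π u) (hΦf : ∀ u, Φf u ≫ fiberι π u = fiberι π u ≫ Φ)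
    {t s : U} (γ : Path.Homotopic.Quotient t s)
    {A B : AbelianVariety ℂ} (eA : A.X ≅ fiberOver π t.1) (eB : B.X ≅ fiberOver π s.1) {φ : A ⟶ A} {ψ : B ⟶ B}
    (heA : eA.hom ≫ Φf t.1 = φ.hom.hom.hom ≫ eA.hom) (heB : eB.hom ≫ Φf s.1 = ψ.hom.hom.hom ≫ eB.hom)
    {P : Polynomial ℤ} {r : ℕ} {c : complexBetti A.X r} (hc : c ∈ weilClassesField A φ P r) :
    complexBetti.map eB.hom r (transportFun π r hU γ (complexBetti.map eA.inv r c)) ∈ weilClassesField B ψ P r := by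
  -- the charted transport as one linear map `T`
  let T : complexBetti A.X r →ₗ[ℂ] complexBetti B.X r :=
    (complexBetti.map eB.hom r).hom ∘ₗ transportLinear π r hU γ ∘ₗ (complexBetti.map eA.inv r).hom
  have hT : ∀ c', T c' = complexBetti.map eB.hom r (transportFun π r hU γ (complexBetti.map eA.inv r c')) := fun c' => rfl
  have hle : (weilClassesField A φ P r).map T ≤ weilClassesField B ψ P r := by
    unfold weilClassesField
    rw [Submodule.map_iSup]
    refine iSup_le fun ρ => ?_
    rw [Submodule.map_iSup]
    refine iSup_le fun hρ => ?_
    refine le_trans ?_ (pullbackEigenclasses_le_weilClassesField hρ)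
    rintro _ ⟨c', hc', rfl⟩
    rw [hT]
    exact map_transport_mem_pullbackEigenclasses π hU Φ hΦ Φf hΦf γ eA eB heA heB r _ hc'
  rw [← hT]
  exact hle ⟨c, hc, rfl⟩

/-- **`W_F ⊗ ℂ` is flat for the global `E`-action** (restrictions of a global class): with the data above and a global `W ∈ Hʳ(𝒳(ℂ); ℂ)`, if
`e_A^*(W|X_t) ∈ weilClassesField A φ P r` then `e_B^*(W|X_s) ∈ weilClassesField B ψ P r` — the transport fixes the restrictions of `W`
(`transportFun_map_fiberι`). Part L-e's `mem_weilClassesPlus/Minus_of_transport` are the two summands of the case `P = T² + d`.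
[cite: Deligne1982HodgeCycles, §4 proof of Thm. 4.8 (pp. 48–50)] [cite: Andre1996Motifs, §6.3 Lemme 6.3.3 (iii) (p. 33)]
[cite: MoonenZarhin1998WeilClasses, §1] -/
theorem mem_weilClassesField_of_transport (hU : IsCohomologicallyLocallyTrivialOn π U) (Φ : 𝒳 ⟶ 𝒳) (hΦ : Φ ≫ π = π)
    (Φf : ∀ u : ComplexPoints S, fiberOver π u ⟶ fiberOver π u) (hΦf : ∀ u, Φf u ≫ fiberι π u = fiberι π u ≫ Φ)
    {t s : U} (γ : Path.Homotopic.Quotient t s)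
    {A B : AbelianVariety ℂ} (eA : A.X ≅ fiberOver π t.1) (eB : B.X ≅ fiberOver π s.1) {φ : A ⟶ A} {ψ : B ⟶ B}
    (heA : eA.hom ≫ Φf t.1 = φ.hom.hom.hom ≫ eA.hom) (heB : eB.hom ≫ Φf s.1 = ψ.hom.hom.hom ≫ eB.hom)
    {P : Polynomial ℤ} {r : ℕ} (W : complexBetti 𝒳 r)
    (hW : complexBetti.map eA.hom r (complexBetti.map (fiberι π t.1) r W) ∈ weilClassesField A φ P r) :
    complexBetti.map eB.hom r (complexBetti.map (fiberι π s.1) r W) ∈ weilClassesField B ψ P r := by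
  have hT : complexBetti.map eB.hom r (transportFun π r hU γ (complexBetti.map eA.inv r
      (complexBetti.map eA.hom r (complexBetti.map (fiberι π t.1) r W)))) =
      complexBetti.map eB.hom r (complexBetti.map (fiberι π s.1) r W) := by
    rw [eA.complexBetti_map_inv_map_hom, transportFun_map_fiberι]
  rw [← hT]
  exact map_transport_mem_weilClassesField π hU Φ hΦ Φf hΦf γ eA eB heA heB hW

end Transport

/-! ## §2 Compact abelian pencils: `W_E ⊗ ℂ` at every member from the datum at ONE member -/

section Pencil

variable {𝒳 S : SchemeOver ℂ} {f : 𝒳 ⟶ S} {d : ℕ}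

/-- **`W_E ⊗ ℂ` FROM THE DATUM AT `t`: on a compact pencil of abelian varieties with a global endomorphism `Φ` over `S` and `Φ`-compatible charts
`(A_s, e_s, φ_s)`, a global class `U ∈ Hʳ(𝒳(ℂ); ℂ)` with `e_t^*(U|X_t) ∈ weilClassesField (A t) (φ t) P r` at ONE member has
`e_s^*(U|X_s) ∈ weilClassesField (A s) (φ s) P r` at EVERY member** (Ehresmann on complex points: `R^r f_* ℂ` is a local system over all of
`S(ℂ)`; `S(ℂ)` is path connected; §1). For `F = ℚ(φ)` a CM field acting on the members this is Deligne's "`⋀_E^d H¹(Y_s)` is a sub-local system" /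
André's "section globale `ξ̃`", from ONE global endomorphism and with no abelian-scheme structure constructed.
[cite: Deligne1982HodgeCycles, §4 proof of Thm. 4.8 (pp. 48–50)] [cite: Andre1996Motifs, §6.3 Lemme 6.3.3 (iii) (p. 33)]
[cite: VoisinHodgeI2002, Thm. 9.3 and §9.2.1] -/
theorem map_chart_fiberι_mem_weilClassesField_member_of_member (hf : IsCompactAbelianPencil f d)
    (Φ : 𝒳 ⟶ 𝒳) (hΦ : Φ ≫ f = f)
    (A : ComplexPoints S → AbelianVariety ℂ) (e : ∀ s, (A s).X ≅ fiberOver f s) (φ : ∀ s, A s ⟶ A s)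
    (hK : ∀ s, ∃ Φs : fiberOver f s ⟶ fiberOver f s, Φs ≫ fiberι f s = fiberι f s ≫ Φ ∧ (e s).hom ≫ Φs = (φ s).hom.hom.hom ≫ (e s).hom)
    {P : Polynomial ℤ} {r : ℕ} (U₁ : complexBetti 𝒳 r) {t : ComplexPoints S}
    (hUt : complexBetti.map (e t).hom r (complexBetti.map (fiberι f t) r U₁) ∈ weilClassesField (A t) (φ t) P r)
    (s : ComplexPoints S) :
    complexBetti.map (e s).hom r (complexBetti.map (fiberι f s) r U₁) ∈ weilClassesField (A s) (φ s) P r := by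
  choose Φf hΦf he using hK
  haveI : IsProper S.hom := IsSmoothProjective.isProper_holds hf.isSmoothProjective_base
  haveI : CompactSpace S.left := QuasiCompact.compactSpace_of_compactSpace S.hom
  haveI := hf.isSmoothProjective_base.smoothOfRelativeDimension
  haveI : IsProper f.left := hf.isSmoothProjectiveFamily.isProper
  haveI := hf.isSmoothProjectiveFamily.smoothOfRelativeDimension
  haveI := connectedSpace_complexPoints hf.isSmoothProjective_base
  haveI := pathConnectedSpace_complexPoints_of_smoothOfRelativeDimension S 1
  have hcont : Continuous fun x : ComplexPoints S => (⟨x, Set.mem_univ x⟩ : (Set.univ : Set (ComplexPoints S))) :=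
    continuous_id.subtype_mk _
  exact mem_weilClassesField_of_transport f (isCohomologicallyLocallyTrivialOn_univ f d 1) Φ hΦ Φf hΦf
    (t := ⟨t, Set.mem_univ t⟩) (s := ⟨s, Set.mem_univ s⟩) ⟦(PathConnectedSpace.somePath t s).map hcont⟧
    (e t) (e s) (he t) (he s) U₁ hUt

end Pencil

end Summit.HodgeConjecture.HodgeConjecture.Ring2.AbelianAll

end
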